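import Summits.CriticalPhenomena.PercolationContinuityZ3.Theorems.PercNearOneGluingNoHeavyLowerTailSahiThreeCopyCellAccum

/-!
# `NoHeavyLowerTail` (crux stmt-CriticalPhenomena-4575), Sahi programme: **CELL CERTIFICATES III — the checker `checkCell` and its
# SOUNDNESS** (`checkCell = true` ⇒ (N1) for all nonnegative monotone `κ` and (N2) on the cell ⇒ `PointwiseTP` ⇒ `LawGood`)

Support file (Sahi cell, seat `prim-sahi-p1`, generation 65; `--supports stmt-CriticalPhenomena-4575`); part III of the verified cell-certificate
checker (parts I/II `…CellMirror`, `…CellAccum`; consumers: the data files `…CellData*` and the instances `…CellC8`, `…CellF7`).  No evaluation in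
this file; no `sorry`, standard axioms.

CONTENT (memo FROM-prim-sahi-p1-gen64 §7–§10).  A `CellCertificate` (integers: denominator `D`; sparse `rho`, `sig`; transfers `lam = [(p,q,x)]`;
products `[(u,v,x)]` of generators) is ACCEPTED by `checkCell k π fZ ℓZ M P Q` iff `D > 0`, all coefficients `≥ 0`, transfers along `p ≤ q`,
generators admissible for the ordered cell `(P,Q)`, `ρ` supported on first copies, and EXACTLY (K) `D·cK = ρ + Σλ(e_q − e_p) + σ` at all `2^k`
levels and (GH) `diag(ρ) + D·B = Σ x·u ⊗ v` at all `4^k` pairs (integer mirrors `cKZ`, `BZ`; arrays `kArr`, `ghArr`).  ★★ `cellFacts_of_checkCell`: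
acceptance ⇒ `CellFacts` (the weight `θ_{ρ/D} ≥ 0` satisfies (N1) against `1` for every nonnegative monotone `κ` and (N2) at every nonnegative
monotone pair of the cell) — proof: `N1form_split`/`N2form_split`, the bridges of part I, the array semantics of part II, and positivity of
admissible generators on the cell; ★ `pointwiseTP_of_cellFacts` / `lawGood_of_cellFacts`: facts on all `M²` ordered cells ⇒ `PointwiseTP` ⇒
`LawGood` (`pointwiseTP_of_cells`, `lawGood_of_pointwiseTP`, gen 64).  Finally the UNVERIFIED producers (only their output is checked):
`CellReps` (orbit representatives + the group `Γ` as explicit `(τ, β)` pairs), `CellReps.expand` (every distinct `Γ`-image of a representative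
carries its coefficient), `CellCertificate.transport` (outer symmetry, optional transposition), and the dominant-block score `transScore`. [this work]
-/

namespace Summit.CriticalPhenomena.PercolationContinuityZ3.Theorems.SahiThreeCopy

open Finset Function Literature.Combinatorics.Sahi2008
open scoped BigOperators

variable {k : ℕ}

/-! ### §5 The checker and its soundness -/

/-- A CELL CERTIFICATE in expanded integer form: denominator `D`, diagonal `rho`, slack `sig` (sparse, by point code), transfers
`lam = [(p, q, x)]` and products `[(u, v, x)]` of generators. [this work] -/
structure CellCertificate where
  /-- common denominator -/ D : ℕ
  /-- `D·ρ` as a sparse vector -/ rho : List (ℕ × ℤ)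
  /-- `D·σ` as a sparse vector -/ sig : List (ℕ × ℤ)
  /-- transfers `(p, q, D·λ)` -/ lam : List (ℕ × ℕ × ℤ)
  /-- products `(u, v, D·x)` -/ prods : List (Gen × Gen × ℤ)

/-- The (K)-array of a certificate: `ρ + σ + Σ λ (e_q − e_p)` by point code. [this work] -/
def CellCertificate.kArr (k : ℕ) (C : CellCertificate) : Array ℤ :=
  addLam (addEntries (addEntries (Array.replicate (2 ^ k) 0) C.rho) C.sig) C.lam

/-- The (GH)-array of a certificate: `Σ x · u ⊗ v` by pairs of point codes. [this work] -/
def CellCertificate.ghArr (k : ℕ) (ℓZ : ℕ → Pt k → ℤ) (C : CellCertificate) : Array (Array ℤ) :=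
  accGH (Array.replicate (2 ^ k) (Array.replicate (2 ^ k) 0)) (C.prods.map fun t => (genSparse k ℓZ t.1, genSparse k ℓZ t.2.1, t.2.2))

/-- ★ THE CHECKER.  `checkCell k π fZ ℓZ M P Q C` decides: `D > 0`; all coefficients `≥ 0`; transfers along `p ≤ q` with codes in range;
generators admissible for the cell `(P, Q)` among `M` blocks; `ρ` supported on first copies; (K) `D·cK = ρ + Σλ(e_q − e_p) + σ` at every
level; (GH) `diag(ρ) + D·B = Σ x·u ⊗ v` at every pair of levels (`cK`, `B` through the integer mirrors `cKZ`, `BZ`). [this work] -/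
def checkCell (k : ℕ) (π : Fin k → ℕ) (fZ : Pt k → ℤ) (ℓZ : ℕ → Pt k → ℤ) (M P Q : ℕ) (C : CellCertificate) : Bool :=
  let N := 2 ^ k
  let K := C.kArr k
  let A := C.ghArr k ℓZ
  decide (0 < C.D)
  && C.rho.all (fun pa => decide (0 ≤ pa.2))
  && C.sig.all (fun pa => decide (0 ≤ pa.2))
  && C.lam.all (fun t => decide (t.1 < N) && decide (t.2.1 < N) && (t.1 ||| t.2.1 == t.2.1) && decide (0 ≤ t.2.2))
  && C.prods.all (fun t => genOK k M P t.1 && genOK k M Q t.2.1 && decide (0 ≤ t.2.2))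
  && (List.range N).all (fun n => decide (evalSparse C.rho n = 0) || decide (nArr1Z π (ptOfCode k n) ≠ 0))
  && (List.range N).all (fun n => decide (K[n]? = some ((C.D : ℤ) * cKZ π fZ (ptOfCode k n))))
  && (List.range N).all (fun i => (List.range N).all fun j =>
        decide (entry2 A i j = some ((if i = j then evalSparse C.rho i else 0) + (C.D : ℤ) * BZ π fZ (ptOfCode k i) (ptOfCode k j))))

/-- The diagonal weight `ρ = (D·ρ)/D` of a certificate as a real level function. [this work] -/
noncomputable def CellCertificate.rhoR (k : ℕ) (C : CellCertificate) : Pt k → ℝ :=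
  fun e => (evalSparse C.rho (codeOf k e) : ℝ) / (C.D : ℝ)

/-- What a valid cell certificate DELIVERS for the ordered cell `(P, Q)`: a weight `θ ≥ 0` with (N1) for all nonnegative monotone `κ`
(against `1`) and (N2) on the nonnegative monotone pairs of the cell (`φ` dominated by score `P`, `ψ` by score `Q`). [this work] -/
def CellFacts (k : ℕ) (π : Fin k → ℕ) (f : Pt k → ℝ) (M : ℕ) (ℓ : ℕ → Pt k → ℝ) (P Q : ℕ)
    (θ : Pt k → Pt k → Pt k → ℝ) : Prop :=
  (∀ e₁ e₂ e₃, 0 ≤ θ e₁ e₂ e₃) ∧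
  (∀ κ : Pt k → ℝ, (∀ e, 0 ≤ κ e) → Monotone κ → 0 ≤ N1form k π f θ κ 1) ∧
  (∀ φ ψ : Pt k → ℝ, (∀ e, 0 ≤ φ e) → (∀ e, 0 ≤ ψ e) → Monotone φ → Monotone ψ →
    (∀ j, j < M → ∑ e, ℓ j e * φ e ≤ ∑ e, ℓ P e * φ e) → (∀ j, j < M → ∑ e, ℓ j e * ψ e ≤ ∑ e, ℓ Q e * ψ e) →
    0 ≤ N2form k π f θ φ ψ)

/-- Unpacking `checkCell = true`. [this work] -/
theorem checkCell_spec {π : Fin k → ℕ} {fZ : Pt k → ℤ} {ℓZ : ℕ → Pt k → ℤ} {M P Q : ℕ} {C : CellCertificate}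
    (h : checkCell k π fZ ℓZ M P Q C = true) :
    0 < C.D ∧ (∀ pa ∈ C.rho, 0 ≤ pa.2) ∧ (∀ pa ∈ C.sig, 0 ≤ pa.2)
    ∧ (∀ t ∈ C.lam, t.1 < 2 ^ k ∧ t.2.1 < 2 ^ k ∧ t.1 ||| t.2.1 = t.2.1 ∧ 0 ≤ t.2.2)
    ∧ (∀ t ∈ C.prods, genOK k M P t.1 = true ∧ genOK k M Q t.2.1 = true ∧ 0 ≤ t.2.2)
    ∧ (∀ n, n < 2 ^ k → evalSparse C.rho n = 0 ∨ nArr1Z π (ptOfCode k n) ≠ 0)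
    ∧ (∀ n, n < 2 ^ k → (C.kArr k)[n]? = some ((C.D : ℤ) * cKZ π fZ (ptOfCode k n)))
    ∧ (∀ i j, i < 2 ^ k → j < 2 ^ k → entry2 (C.ghArr k ℓZ) i j =
        some ((if i = j then evalSparse C.rho i else 0) + (C.D : ℤ) * BZ π fZ (ptOfCode k i) (ptOfCode k j))) := by
  unfold checkCell at h
  simp only [Bool.and_eq_true, List.all_eq_true, decide_eq_true_eq, Bool.or_eq_true, beq_iff_eq, List.mem_range] at h
  obtain ⟨⟨⟨⟨⟨⟨⟨hD, hrho⟩, hsig⟩, hlam⟩, hprods⟩, hn⟩, hK⟩, hGH⟩ := h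
  exact ⟨hD, hrho, hsig, fun t ht => by simpa [and_assoc] using hlam t ht, fun t ht => by simpa [and_assoc] using hprods t ht, hn,
    hK, fun i j hi hj => hGH i hi j hj⟩

/-- The (K)-array at an in-range code. [this work] -/
theorem kArr_get (C : CellCertificate) {n : ℕ} (hn : n < 2 ^ k) :
    (C.kArr k)[n]? = some (evalSparse C.rho n + evalSparse C.sig n + lamEval C.lam n) := by
  unfold CellCertificate.kArr
  rw [getElem?_addLam, getElem?_addEntries, getElem?_addEntries, Array.getElem?_replicate, if_pos hn]
  simp

/-- `ghEval` of the sparse forms of admissible products, at codes of levels, is the termwise real/integer product sum. [this work] -/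
theorem ghEval_map_genSparse (ℓZ : ℕ → Pt k → ℤ) {M P Q : ℕ} : ∀ (L : List (Gen × Gen × ℤ)),
    (∀ t ∈ L, genOK k M P t.1 = true ∧ genOK k M Q t.2.1 = true ∧ 0 ≤ t.2.2) → ∀ e e' : Pt k,
    ghEval (L.map fun t => (genSparse k ℓZ t.1, genSparse k ℓZ t.2.1, t.2.2)) (codeOf k e) (codeOf k e') =
      (L.map fun t => t.2.2 * (genFunZ k ℓZ t.1 e * genFunZ k ℓZ t.2.1 e')).sum
  | [], _, e, e' => by simp [ghEval]
  | t :: L, hL, e, e' => by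
    have ht := hL t (by simp)
    rw [List.map_cons, ghEval, List.map_cons, List.sum_cons, ghEval_map_genSparse ℓZ L (fun s hs => hL s (by simp [hs])),
      evalSparse_genSparse ℓZ ht.1, evalSparse_genSparse ℓZ ht.2.1]
    ring

/-- The (GH)-array at in-range codes of levels. [this work] -/
theorem ghArr_get (ℓZ : ℕ → Pt k → ℤ) {M P Q : ℕ} (C : CellCertificate)
    (hp : ∀ t ∈ C.prods, genOK k M P t.1 = true ∧ genOK k M Q t.2.1 = true ∧ 0 ≤ t.2.2) (e e' : Pt k) :
    entry2 (C.ghArr k ℓZ) (codeOf k e) (codeOf k e') =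
      some ((C.prods.map fun t => t.2.2 * (genFunZ k ℓZ t.1 e * genFunZ k ℓZ t.2.1 e')).sum) := by
  unfold CellCertificate.ghArr
  rw [entry2_accGH, entry2_replicate (codeOf_lt k e) (codeOf_lt k e'), ghEval_map_genSparse ℓZ C.prods hp]
  simp

/-- Indicator sums at a code pick out the decoded level. [this work] -/
theorem sum_ite_codeOf (κ : Pt k → ℝ) {q : ℕ} (hq : q < 2 ^ k) :
    ∑ e : Pt k, (if q = codeOf k e then κ e else 0) = κ (ptOfCode k q) := by
  have : ∀ e : Pt k, (if q = codeOf k e then κ e else 0) = if e = ptOfCode k q then κ e else 0 := by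
    intro e
    exact if_congr (by rw [eq_comm]; exact codeOf_eq_iff k e hq) rfl rfl
  simp only [this, Finset.sum_ite_eq', mem_univ, if_true]

/-- The transfers of a well-formed list act on `κ` as `Σ x (κ(q) − κ(p))`. [this work] -/
theorem sum_lamEval_mul (κ : Pt k → ℝ) : ∀ (L : List (ℕ × ℕ × ℤ)), (∀ t ∈ L, t.1 < 2 ^ k ∧ t.2.1 < 2 ^ k ∧ t.1 ||| t.2.1 = t.2.1 ∧ 0 ≤ t.2.2) →
    ∑ e : Pt k, (lamEval L (codeOf k e) : ℝ) * κ e = (L.map fun t => (t.2.2 : ℝ) * (κ (ptOfCode k t.2.1) - κ (ptOfCode k t.1))).sum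
  | [], _ => by simp [lamEval]
  | t :: L, hL => by
    have ht := hL t (by simp)
    have ih := sum_lamEval_mul κ L (fun s hs => hL s (by simp [hs]))
    simp only [lamEval, Int.cast_add, Int.cast_mul, Int.cast_sub, Int.cast_ite, Int.cast_one, Int.cast_zero, add_mul, sum_add_distrib,
      ih, List.map_cons, List.sum_cons]
    congr 1
    have h1 : ∀ e : Pt k, (t.2.2 : ℝ) * ((if t.2.1 = codeOf k e then (1:ℝ) else 0) - (if t.1 = codeOf k e then 1 else 0)) * κ e =
        (t.2.2 : ℝ) * (if t.2.1 = codeOf k e then κ e else 0) - (t.2.2 : ℝ) * (if t.1 = codeOf k e then κ e else 0) := by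
      intro e; split_ifs <;> ring
    simp only [h1, sum_sub_distrib, ← mul_sum, sum_ite_codeOf κ ht.1, sum_ite_codeOf κ ht.2.1]
    ring

/-- Casting an integer list sum of a map to `ℝ` (plumbing). [this work] -/
theorem intCast_sum_map {α : Type*} (g : α → ℤ) : ∀ (L : List α), (((L.map g).sum : ℤ) : ℝ) = (L.map fun t => (g t : ℝ)).sum
  | [] => by simp
  | a :: L => by simp [intCast_sum_map g L]

/-- ★★ **SOUNDNESS OF THE CHECKER.**  A certificate accepted by `checkCell` for the cell `(P, Q)` delivers `CellFacts` for the slot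
`f = fZ` (cast to `ℝ`), the scores `ℓ_j = ℓZ j` and the weight `θ_{ρ/D}`. [this work] -/
theorem cellFacts_of_checkCell {π : Fin k → ℕ} {fZ : Pt k → ℤ} {ℓZ : ℕ → Pt k → ℤ} {M P Q : ℕ} {C : CellCertificate}
    (h : checkCell k π fZ ℓZ M P Q C = true) :
    CellFacts k π (fun x => (fZ x : ℝ)) M (fun j e => (ℓZ j e : ℝ)) P Q (thetaOf π (C.rhoR k)) := by
  obtain ⟨hD, hrho, hsig, hlam, hprods, hn, hK, hGH⟩ := checkCell_spec h
  have hDpos : (0 : ℝ) < (C.D : ℝ) := by exact_mod_cast hD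
  have hρ0 : ∀ e, 0 ≤ C.rhoR k e := fun e =>
    div_nonneg (by exact_mod_cast evalSparse_nonneg C.rho hrho _) hDpos.le
  have hn' : ∀ e, nArr1 π e ≠ 0 ∨ C.rhoR k e = 0 := by
    intro e
    rcases hn (codeOf k e) (codeOf_lt k e) with h0 | h0
    · right; simp [CellCertificate.rhoR, h0]
    · left; rw [nArr1_eq_nArr1Z, ptOfCode_codeOf] at *; exact_mod_cast h0
  -- the (K) identity at a level
  have hKe : ∀ e : Pt k, (C.D : ℝ) * cKcoef π (fun x => (fZ x : ℝ)) e =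
      (evalSparse C.rho (codeOf k e) : ℝ) + (evalSparse C.sig (codeOf k e) : ℝ) + (lamEval C.lam (codeOf k e) : ℝ) := by
    intro e
    have h1 := hK (codeOf k e) (codeOf_lt k e)
    rw [kArr_get C (codeOf_lt k e), ptOfCode_codeOf] at h1
    have h2 := Option.some.inj h1
    rw [cKcoef_eq_cKZ]; exact_mod_cast h2.symm
  -- the (GH) identity at a pair of levels
  have hGHe : ∀ e e' : Pt k, (if e = e' then (evalSparse C.rho (codeOf k e) : ℝ) else 0) + (C.D : ℝ) * Bcoef π (fun x => (fZ x : ℝ)) e e' =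
      ((C.prods.map fun t => (fun x => (genFunZ k ℓZ t.1 x : ℝ), fun x => (genFunZ k ℓZ t.2.1 x : ℝ), (t.2.2 : ℝ))).map
        fun t => t.2.2 * (t.1 e * t.2.1 e')).sum := by
    intro e e'
    have h1 := hGH (codeOf k e) (codeOf k e') (codeOf_lt k e) (codeOf_lt k e')
    rw [ghArr_get ℓZ C hprods, ptOfCode_codeOf, ptOfCode_codeOf] at h1
    have h2 := Option.some.inj h1
    have hij : (codeOf k e = codeOf k e') ↔ (e = e') :=
      ⟨fun hh => by rw [← ptOfCode_codeOf k e, hh, ptOfCode_codeOf], fun hh => by rw [hh]⟩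
    rw [if_congr hij rfl rfl] at h2
    rw [Bcoef_eq_BZ, List.map_map]
    have h3 : ((if e = e' then (evalSparse C.rho (codeOf k e) : ℝ) else 0) + (C.D : ℝ) * (BZ π fZ e e' : ℝ)) =
        (((if e = e' then evalSparse C.rho (codeOf k e) else 0) + (C.D : ℤ) * BZ π fZ e e' : ℤ) : ℝ) := by push_cast; split_ifs <;> simp
    rw [h3, ← h2, intCast_sum_map]
    congr 1
    refine List.map_congr_left fun t _ => ?_
    simp only [Function.comp]
    push_cast; ring
  refine ⟨fun e₁ e₂ e₃ => thetaOf_nonneg π hρ0 e₁ e₂ e₃, ?_, ?_⟩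
  · -- (N1)
    intro κ hκ0 hκm
    rw [N1form_split, N1form_zero_eq, thetaLin_thetaOf π _ _ hn']
    simp only [Pi.mul_apply, Pi.one_apply, mul_one]
    rw [← sum_sub_distrib]
    have hDne : (C.D : ℝ) ≠ 0 := hDpos.ne'
    have key : ∀ e, cKcoef π (fun x => (fZ x : ℝ)) e * κ e - C.rhoR k e * κ e =
        (1 / (C.D : ℝ)) * (((evalSparse C.sig (codeOf k e) : ℝ)) * κ e + (lamEval C.lam (codeOf k e) : ℝ) * κ e) := by
      intro e
      have hc : cKcoef π (fun x => (fZ x : ℝ)) e =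
          ((evalSparse C.rho (codeOf k e) : ℝ) + (evalSparse C.sig (codeOf k e) : ℝ) + (lamEval C.lam (codeOf k e) : ℝ)) / (C.D : ℝ) := by
        rw [eq_div_iff hDne, mul_comm]; exact hKe e
      simp only [CellCertificate.rhoR, hc]
      field_simp
      ring
    simp only [key, ← mul_sum, sum_add_distrib]
    refine mul_nonneg (by positivity) (add_nonneg (sum_nonneg fun e _ => mul_nonneg ?_ (hκ0 e)) ?_)
    · exact_mod_cast evalSparse_nonneg C.sig hsig _
    · rw [sum_lamEval_mul κ C.lam hlam]
      refine List.sum_nonneg ?_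
      intro x hx
      rw [List.mem_map] at hx
      obtain ⟨t, ht, rfl⟩ := hx
      have htt := hlam t ht
      exact mul_nonneg (by exact_mod_cast htt.2.2.2) (sub_nonneg.2 (hκm (ptOfCode_le_of_lor htt.2.2.1)))
  · -- (N2) on the cell
    intro φ ψ hφ hψ hφm hψm hφc hψc
    rw [N2form_split, N2form_zero_eq, thetaLin_thetaOf π _ _ hn']
    simp only [Pi.mul_apply]
    have hdiag : ∑ e : Pt k, C.rhoR k e * (φ e * ψ e) =
        ∑ e : Pt k, ∑ e' : Pt k, (if e = e' then C.rhoR k e else 0) * (φ e * ψ e') := by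
      refine sum_congr rfl fun e _ => ?_
      rw [Finset.sum_eq_single e]
      · simp
      · intro e' _ he; simp [Ne.symm he]
      · intro hh; exact absurd (mem_univ _) hh
    rw [hdiag, ← sum_add_distrib]
    have key : ∀ e, (∑ e', Bcoef π (fun x => (fZ x : ℝ)) e e' * (φ e * ψ e')) + ∑ e', (if e = e' then C.rhoR k e else 0) * (φ e * ψ e') =
        (1 / (C.D : ℝ)) * ∑ e', ((C.prods.map fun t => (fun x => (genFunZ k ℓZ t.1 x : ℝ), fun x => (genFunZ k ℓZ t.2.1 x : ℝ), (t.2.2 : ℝ))).map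
          fun t => t.2.2 * (t.1 e * t.2.1 e')).sum * (φ e * ψ e') := by
      intro e
      rw [← sum_add_distrib, mul_sum]
      refine sum_congr rfl fun e' _ => ?_
      rw [← hGHe e e']
      have hDne : (C.D : ℝ) ≠ 0 := hDpos.ne'
      simp only [CellCertificate.rhoR]
      by_cases hee : e = e'
      · subst hee; simp only [if_true]; field_simp; ring
      · simp only [hee, if_false]; field_simp; ring
    simp only [key, ← mul_sum]
    refine mul_nonneg (by positivity) ?_
    rw [sum_rankOne_eq]
    refine rankOne_nonneg _ ?_ ?_ ?_
    · intro t ht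
      rw [List.mem_map] at ht
      obtain ⟨s, hs, rfl⟩ := ht
      change (0 : ℝ) ≤ (s.2.2 : ℝ)
      exact_mod_cast (hprods s hs).2.2
    · intro t ht
      rw [List.mem_map] at ht
      obtain ⟨s, hs, rfl⟩ := ht
      exact genFun_dot_nonneg ℓZ (hprods s hs).1 hφ hφm hφc
    · intro t ht
      rw [List.mem_map] at ht
      obtain ⟨s, hs, rfl⟩ := ht
      exact genFun_dot_nonneg ℓZ (hprods s hs).2.1 hψ hψm hψc

/-- ★ From `CellFacts` on every ordered cell `(p, q)`, `p, q < M` (`M ≥ 1` scores), to the POINTWISE TWO-POINT PROPERTY `(L*)` —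
the finite cover argument `pointwiseTP_of_cells` with `ℕ`-indexed scores and cells. [this work] -/
theorem pointwiseTP_of_cellFacts {π : Fin k → ℕ} {f : Pt k → ℝ} {M : ℕ} (hM : 0 < M) (ℓ : ℕ → Pt k → ℝ)
    (θ : ℕ → ℕ → Pt k → Pt k → Pt k → ℝ) (h : ∀ p q, p < M → q < M → CellFacts k π f M ℓ p q (θ p q)) :
    PointwiseTP k π f := by
  refine pointwiseTP_of_cells k π f hM (fun j : Fin M => ℓ j.val) (fun p q => θ p.val q.val)
    (fun p q => (h p.val q.val p.isLt q.isLt).1) (fun p q κ hκ0 hκm => ?_) (fun p q φ ψ hφ hψ hφm hψm hp hq => ?_)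
  · exact (h p.val q.val p.isLt q.isLt).2.1 κ hκ0 hκm
  · exact (h p.val q.val p.isLt q.isLt).2.2 φ ψ hφ hψ hφm hψm (fun j hj => hp ⟨j, hj⟩) (fun j hj => hq ⟨j, hj⟩)

/-- ★ … hence `LawGood`: the slot at that front profile is good AT LAW LEVEL against every back cube (`lawGood_of_pointwiseTP`). [this work] -/
theorem lawGood_of_cellFacts {π : Fin k → ℕ} {f : Pt k → ℝ} {M : ℕ} (hM : 0 < M) (ℓ : ℕ → Pt k → ℝ)
    (θ : ℕ → ℕ → Pt k → Pt k → Pt k → ℝ) (h : ∀ p q, p < M → q < M → CellFacts k π f M ℓ p q (θ p q)) :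
    LawGood k π f :=
  lawGood_of_pointwiseTP (pointwiseTP_of_cellFacts hM ℓ θ h)

/-! ### Orbit representatives, expansion by a symmetry group, transport (UNVERIFIED producers of certificates — only the
expanded certificate is checked) -/

/-- A cell certificate in ORBIT-REPRESENTATIVE form together with the group `Γ` (explicit list of `(τ, β)`: `τ` a coordinate
permutation as the list of images, `β` the induced block permutation). [this work] -/
structure CellReps where
  /-- common denominator -/ D : ℕ
  /-- `D·ρ` representatives -/ rho : List (ℕ × ℤ)
  /-- `D·σ` representatives -/ sig : List (ℕ × ℤ)
  /-- transfer representatives -/ lam : List (ℕ × ℕ × ℤ)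
  /-- product representatives -/ prods : List (Gen × Gen × ℤ)
  /-- the group, as `(τ, β)` pairs -/ gamma : List (List ℕ × List ℕ)

/-- Image of a point code under a coordinate map `τ` (bit `b` ↦ bit `τ[b]`). [this work] -/
def actPt (τ : List ℕ) (p : ℕ) : ℕ :=
  (List.range τ.length).foldl (fun acc b => if p.testBit b then acc ||| (1 <<< τ.getD b 0) else acc) 0

/-- Image of a generator under `(τ, β)`: points and covers by `τ`, score indices by `β`. [this work] -/
def actGen (g : List ℕ × List ℕ) (u : Gen) : Gen :=
  if u.1 = 0 then (0, actPt g.1 u.2.1, 0)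
  else if u.1 = 1 then (1, actPt g.1 u.2.1, actPt g.1 u.2.2)
  else (u.1, g.2.getD u.2.1 0, g.2.getD u.2.2 0)

/-- EXPANSION of orbit representatives: every distinct image under `Γ` carries the representative's coefficient. [this work] -/
def CellReps.expand (R : CellReps) : CellCertificate where
  D := R.D
  rho := R.rho.flatMap fun px => ((R.gamma.map fun g => actPt g.1 px.1).eraseDups).map fun q => (q, px.2)
  sig := R.sig.flatMap fun px => ((R.gamma.map fun g => actPt g.1 px.1).eraseDups).map fun q => (q, px.2)
  lam := R.lam.flatMap fun t => ((R.gamma.map fun g => (actPt g.1 t.1, actPt g.1 t.2.1)).eraseDups).map fun pq => (pq.1, pq.2, t.2.2)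
  prods := R.prods.flatMap fun t => ((R.gamma.map fun g => (actGen g t.1, actGen g t.2.1)).eraseDups).map fun uv => (uv.1, uv.2, t.2.2)

/-- TRANSPORT of a certificate by an outer symmetry `(τ, β)`, optionally TRANSPOSED (`u ⊗ v ↦ v ⊗ u`, for the mirrored cell). [this work] -/
def CellCertificate.transport (g : List ℕ × List ℕ) (transpose : Bool) (C : CellCertificate) : CellCertificate where
  D := C.D
  rho := C.rho.map fun px => (actPt g.1 px.1, px.2)
  sig := C.sig.map fun px => (actPt g.1 px.1, px.2)
  lam := C.lam.map fun t => (actPt g.1 t.1, actPt g.1 t.2.1, t.2.2)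
  prods := C.prods.map fun t => if transpose then (actGen g t.2.1, actGen g t.1, t.2.2) else (actGen g t.1, actGen g t.2.1, t.2.2)

/-- Number of coordinates of a block set in a level. [this work] -/
def blockCount (b : List (Fin k)) (e : Pt k) : ℕ := (b.filter fun i => e i).length

/-- The DOMINANT-BLOCK SCORE `ℓ_j(e) = Σ_{T transversal} ([e = T ∪ block_j] − [e = T])` of a block structure (memo §7, 'trans'):
`|block_j|` if `e` contains block `j` and meets every other block in exactly one coordinate, minus `1` if `e` is a transversal. [this work] -/
def transScore (blocks : List (List (Fin k))) (j : ℕ) (e : Pt k) : ℤ :=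
  let full := (blockCount (blocks.getD j []) e == (blocks.getD j []).length) &&
    ((List.range blocks.length).all fun i => i == j || blockCount (blocks.getD i []) e == 1)
  let trans := (List.range blocks.length).all fun i => blockCount (blocks.getD i []) e == 1
  (if full then ((blocks.getD j []).length : ℤ) else 0) - (if trans then 1 else 0)

end Summit.CriticalPhenomena.PercolationContinuityZ3.Theorems.SahiThreeCopy
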